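import Summits.ValiantsHypothesis.ValiantsHypothesis.Theorems.ZeroOneTransfer.Negative.LowDegreeCofactor
import Summits.ValiantsHypothesis.ValiantsHypothesis.Theorems.PerDivisionHard.Negative.PerSupportBound
import Literature.Computability.AlgebraicComplexity.ValiantClassesProofs

/-!
# `PerDivisionHard` — the LOW-DEGREE RUNG, unconditionally: cofactors of degree `δ` buy at most `δ` rows of the permanent

Crux `stmt-ValiantsHypothesis-5065` (`Theses.DivisionGap.PerDivisionHard`, H1 of route
DivisionGap; also `PerMultiplesHard`, 5068); filed by the standing disprover of the sibling crux
`ZeroOneTransfer` (5066) — the same two moves that refute the low-degree strengthening of H2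
(`ZeroOneTransfer/Negative/LowDegreeCofactor.lean`) PROVE the low-degree rung of H1:

* `perKill R` — the projection `x_{a,i} ↦ 1` (`a ∈ R`), `↦ 0` (`a ∉ R`, `i ∈ R`), rename the rest
  to the complement of `R`; `support_aeval_perKill_perPoly`: it maps `per_n` onto a polynomial
  with the SUPPORT of the permanent of the complement (`shrinkPerm` / `Equiv.Perm.ofSubtype`).
* `exists_support_perPoly_complexity_le` — for `h ≠ 0`: a set `R` of `≤ deg h` rows and `q` with
  the support of `per` on the complement of `R` with `L(q) ≤ L(per_n · h) + 1` (initial forms are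
  free, `complexity_topComponent_le`; `per` is row-homogeneous; `exists_rows_topComponent`).
* `two_pow_le_complexity_perPoly_mul` — **for every nonzero `h ∈ ℝ≥0[x_{ij}]` with
  `deg h + 6 ≤ n`: `2^{(n - deg h)/3} ≤ L_{ℝ≥0}(per_n · h) + 1`.**  Hence `PerMultiplesHard` and
  `PerDivisionHard` hold for all cofactors of degree `≤ n - 3(log₂ n + c)^c - 3`, i.e. the
  foreseen split `LowDegreeMultiplesHard` of the route, without the shadow-complexity input
  `ShadowBirkhoff` (cf. HrubesYehudayoff2021 Prop 43(2), Rem 45–46: transparency methods stop at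
  `deg g ≤ 2^{o(√n)}` and only for transparent `f`; this elementary rung reaches `(1-ε)n`).
  What remains of H1 is exactly the regime `deg h > n - O(polylog n)` — high-degree cofactors
  (`h = ℓ^D`, `h = per^k`, …), where support methods provably degenerate (Disproof.lean `resists`).
[folklore] [cite: JerrumSnir1982, §4.3 and Cor. 3.5]
-/

namespace Summit.ValiantsHypothesis.ValiantsHypothesis.Theorems.PerDivisionHard.Negative

open Literature.Computability.AlgebraicComplexity Literature.Barriers.ValiantsHypothesis
open Summit.ValiantsHypothesis.ValiantsHypothesis.Theorems.ZeroOneTransfer.Negative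
open MvPolynomial Finset
open scoped NNReal

noncomputable section

/-! ### Killing rows of the permanent -/

section PerKill

variable {n : ℕ} (R : Finset (Fin n))

/-- The substitution for the permanent: variables `x_{a,i}` with `a ∈ R` ↦ `1`; with `a ∉ R`,
`i ∈ R` ↦ `0`; the rest renamed to the complement of `R`. [folklore] -/
def perKill : Fin n × Fin n → MvPolynomial ({a : Fin n // a ∉ R} × {a : Fin n // a ∉ R}) ℝ≥0 :=
  fun v => if ha : v.1 ∈ R then 1 else if hi : v.2 ∈ R then 0 else X (⟨v.1, ha⟩, ⟨v.2, hi⟩)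

/-- `perKill` is a projection. [folklore] -/
theorem isProjection_perKill (p : MvPolynomial (Fin n × Fin n) ℝ≥0) :
    IsProjection (aeval (perKill R) p) p := by
  refine ⟨perKill R, fun v => ?_, rfl⟩
  unfold perKill
  by_cases ha : v.1 ∈ R
  · right; exact ⟨1, by simp [ha]⟩
  · by_cases hi : v.2 ∈ R
    · right; exact ⟨0, by simp [ha, hi]⟩
    · left; exact ⟨(⟨v.1, ha⟩, ⟨v.2, hi⟩), by simp [ha, hi]⟩

/-- A permutation mapping `R` into `R` preserves `R` and its complement. [folklore] -/
theorem forall_not_mem_iff_of_maps {π : Equiv.Perm (Fin n)} (h : ∀ i ∈ R, π i ∈ R) :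
    ∀ i, i ∉ R ↔ π i ∉ R := by
  classical
  have himg : R.image π = R := Finset.eq_of_subset_of_card_le
    (fun x hx => by obtain ⟨i, hi, rfl⟩ := Finset.mem_image.mp hx; exact h i hi)
    (by rw [Finset.card_image_of_injective _ π.injective])
  intro i
  constructor
  · intro hi hπi
    rw [← himg] at hπi
    obtain ⟨j, hj, hji⟩ := Finset.mem_image.mp hπi
    exact hi (π.injective hji ▸ hj)
  · intro hπi hi; exact hπi (h i hi)

/-- The shrunk permutation of the complement of `R` (identity if `π` does not map `R` into `R`,
a case that does not occur below). [folklore] -/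
def shrinkPerm (π : Equiv.Perm (Fin n)) : Equiv.Perm {a : Fin n // a ∉ R} := by
  classical
  exact if h : (∀ i ∈ R, π i ∈ R) then
    π.subtypePerm (fun x => (forall_not_mem_iff_of_maps R h x).symm) else 1

/-- The monomial of a permutation mapping `R` into `R` under `perKill`. [folklore] -/
theorem prod_perKill_of_maps {π : Equiv.Perm (Fin n)} (h : ∀ i ∈ R, π i ∈ R) :
    ∏ i : Fin n, perKill R (π i, i) =
      ∏ x : {a : Fin n // a ∉ R}, (X (shrinkPerm R π x, x) :
        MvPolynomial ({a : Fin n // a ∉ R} × {a : Fin n // a ∉ R}) ℝ≥0) := by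
  classical
  have hP := forall_not_mem_iff_of_maps R h
  rw [← Fintype.prod_subtype_mul_prod_subtype (fun i : Fin n => i ∈ R)
    (fun i => perKill R (π i, i))]
  rw [Finset.prod_eq_one (fun x _ => by simp [perKill, h x.1 x.2]), one_mul]
  refine Fintype.prod_congr _ _ fun x => ?_
  have hx : x.1 ∉ R := x.2
  have hπx : π x.1 ∉ R := (hP x.1).mp hx
  simp only [perKill, hx, hπx, dite_false, shrinkPerm, dif_pos h]
  rfl

/-- The monomial of a permutation NOT mapping `R` into `R` vanishes under `perKill`. [folklore] -/
theorem prod_perKill_of_not_maps {π : Equiv.Perm (Fin n)} (h : ∃ i ∈ R, π i ∉ R) :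
    ∏ i : Fin n, perKill R (π i, i) = 0 := by
  obtain ⟨i, hi, hπ⟩ := h
  apply Finset.prod_eq_zero (Finset.mem_univ i)
  simp [perKill, hπ, hi]

/-- `per_n` under `perKill`: the sum of the monomials of the shrunk permutations, over the
permutations mapping `R` into `R`. [folklore] -/
theorem aeval_perKill_perPoly :
    aeval (perKill R) (perPoly (Fin n) ℝ≥0) =
      ∑ π ∈ (Finset.univ : Finset (Equiv.Perm (Fin n))).filter (fun π => ∀ i ∈ R, π i ∈ R),
        monomial (permMonomial (shrinkPerm R π)) (1 : ℝ≥0) := by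
  classical
  rw [perPoly_eq_sum_monomial, map_sum, Finset.sum_filter]
  refine Finset.sum_congr rfl fun π _ => ?_
  rw [show (monomial (permMonomial π) (1 : ℝ≥0) : MvPolynomial _ ℝ≥0) = ∏ i, X (π i, i) by
    rw [permMonomial, monomial_sum_one]; rfl]
  rw [map_prod]
  simp only [aeval_X]
  split_ifs with h
  · rw [prod_perKill_of_maps R h, permMonomial, monomial_sum_one]; rfl
  · push Not at h
    exact prod_perKill_of_not_maps R h

/-- The support of the permanent on any index type: the permutation monomials. [folklore] -/
theorem support_perPoly_univ {ι : Type*} [Fintype ι] [DecidableEq ι] :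
    (perPoly ι ℝ≥0).support = Finset.univ.image permMonomial := by
  ext d
  rw [mem_support_iff, Finset.mem_image]
  constructor
  · intro h
    obtain ⟨ρ, hρ⟩ := exists_permMonomial_eq_of_coeff_perPoly_ne_zero ℝ≥0 h
    exact ⟨ρ, Finset.mem_univ _, hρ⟩
  · rintro ⟨ρ, -, rfl⟩
    rw [coeff_permMonomial_perPoly]; exact one_ne_zero

/-- **The support of `per_n` under `perKill` is the support of the permanent of the complement
of `R`.** [folklore] -/
theorem support_aeval_perKill_perPoly :
    (aeval (perKill R) (perPoly (Fin n) ℝ≥0)).support =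
      (perPoly {a : Fin n // a ∉ R} ℝ≥0).support := by
  classical
  rw [aeval_perKill_perPoly, support_sum_monomial_one, support_perPoly_univ]
  ext d
  simp only [Finset.mem_image, Finset.mem_filter, Finset.mem_univ, true_and]
  constructor
  · rintro ⟨π, -, rfl⟩
    exact ⟨shrinkPerm R π, rfl⟩
  · rintro ⟨σ, rfl⟩
    have hmaps : ∀ i ∈ R, Equiv.Perm.ofSubtype σ i ∈ R := by
      intro i hi
      rw [Equiv.Perm.ofSubtype_apply_of_not_mem σ (show ¬ (i ∉ R) from not_not.mpr hi)]
      exact hi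
    refine ⟨Equiv.Perm.ofSubtype σ, hmaps, ?_⟩
    congr 1
    rw [shrinkPerm, dif_pos hmaps]
    refine Equiv.ext fun x => Subtype.ext ?_
    show (Equiv.Perm.ofSubtype σ) x.1 = (σ x).1
    exact Equiv.Perm.ofSubtype_apply_coe σ x

/-- `per_n` is row-lexicographically homogeneous (each monomial has one variable in each row).
[folklore] -/
theorem isWeightedHomogeneous_perPoly (B : ℕ) :
    IsWeightedHomogeneous (rowWeight B) (perPoly (Fin n) ℝ≥0) (∑ a : Fin n, B ^ (a : ℕ)) := by
  classical
  rw [perPoly_eq_sum_monomial]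
  refine IsWeightedHomogeneous.sum _ _ _ fun π _ => ?_
  refine isWeightedHomogeneous_monomial _ _ _ ?_
  rw [permMonomial, map_sum]
  have hw : ∀ i : Fin n, Finsupp.weight (rowWeight (β := Fin n) B)
      (Finsupp.single (π i, i) 1) = B ^ ((π i : Fin n) : ℕ) := by
    intro i
    rw [Finsupp.weight_apply, Finsupp.sum_single_index (by simp)]
    simp [rowWeight]
  simp_rw [hw]
  exact Equiv.sum_comp π (fun a : Fin n => B ^ (a : ℕ))

end PerKill

/-! ### The low-degree rung of `PerDivisionHard` -/

section Main

variable {n : ℕ}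

/-- **A cofactor of degree `δ` buys at most `δ` rows of the permanent (reduction).**  For every
nonzero `h ∈ ℝ≥0[x]` there is a set `R` of at most `deg h` rows and a polynomial `q` with the
SUPPORT of the permanent of the complement of `R` such that `L(q) ≤ L(per_n · h) + 1`: top
row-lexicographic component (free; `per` is row-homogeneous), the projection `perKill`
(rows `R ↦ 1`, cells `(Rᶜ, R) ↦ 0`) makes the cofactor a nonzero constant, unscale.
[folklore] -/
theorem exists_support_perPoly_complexity_le {h : MvPolynomial (Fin n × Fin n) ℝ≥0}
    (hh : h ≠ 0) :
    ∃ R : Finset (Fin n), R.card ≤ h.totalDegree ∧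
      ∃ q : MvPolynomial ({a : Fin n // a ∉ R} × {a : Fin n // a ∉ R}) ℝ≥0,
        q.support = (perPoly {a : Fin n // a ∉ R} ℝ≥0).support ∧
        complexity q ≤ complexity (perPoly (Fin n) ℝ≥0 * h) + 1 := by
  classical
  set δ := h.totalDegree with hδ
  set W := rowWeight (N := n) (β := Fin n) (δ + 1) with hW
  obtain ⟨R, hRcard, hrows⟩ := exists_rows_topComponent hh
  set hs := topComponent W h with hhs
  have hne : hs ≠ 0 := topComponent_ne_zero _ hh
  refine ⟨R, hRcard, ?_⟩
  -- (1) initial form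
  have h1 : complexity (perPoly (Fin n) ℝ≥0 * hs) ≤ complexity (perPoly (Fin n) ℝ≥0 * h) := by
    have := complexity_topComponent_le W (perPoly (Fin n) ℝ≥0 * h)
    rwa [topComponent_mul, topComponent_eq_self_of_isWeightedHomogeneous W
      (isWeightedHomogeneous_perPoly (δ + 1))] at this
  -- (2) projection
  set q := aeval (perKill R) (perPoly (Fin n) ℝ≥0) with hq
  set η : ℝ≥0 := ∑ d ∈ hs.support, coeff d hs with hη
  have hη0 : η ≠ 0 := sum_coeff_ne_zero hne
  have hrowsC : aeval (perKill R) hs = C η := by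
    rw [hη]
    conv_lhs => rw [hs.as_sum]
    rw [map_sum, map_sum]
    refine Finset.sum_congr rfl fun d hd => ?_
    rw [aeval_monomial, ← C_eq_algebraMap]
    suffices hp : (d.prod fun v k => perKill R v ^ k) = 1 by rw [hp, mul_one]
    refine Finset.prod_eq_one fun v hv => ?_
    have : perKill R v = 1 := by simp [perKill, hrows d hd v hv]
    show perKill R v ^ (d v) = 1
    rw [this, one_pow]
  have h2 : complexity (q * C η) ≤ complexity (perPoly (Fin n) ℝ≥0 * hs) := by
    have := complexity_le_of_isProjection (isProjection_perKill R (perPoly (Fin n) ℝ≥0 * hs))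
    rwa [map_mul, hrowsC] at this
  -- (3) unscale
  have h3 : complexity q ≤ complexity (q * C η) + 1 := by
    have hqq : q = η⁻¹ • (q * C η) := by
      rw [mul_comm, smul_eq_C_mul, ← mul_assoc, ← C_mul, inv_mul_cancel₀ hη0, C_1, one_mul]
    conv_lhs => rw [hqq]
    exact complexity_smul_le_holds _ _
  exact ⟨q, support_aeval_perKill_perPoly R, h3.trans (by omega)⟩

/-- **The low-degree rung of `PerDivisionHard` / `PerMultiplesHard`, unconditionally.**  For
every nonzero `h ∈ ℝ≥0[x_{ij}]` with `deg h + 6 ≤ n`: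
`2^{(n - deg h)/3} ≤ L_{ℝ≥0}(per_n · h) + 1`.  So cofactors of degree `≤ n - ω(polylog n)`
cannot bring the monotone complexity of a multiple of the permanent down to quasi-polynomial —
the foreseen split `LowDegreeMultiplesHard` of the route holds for all `deg h ≤ (1 - ε) n`, with
no shadow-complexity input (cf. HrubesYehudayoff2021 Prop 43(2), Rem 45–46).
[folklore] [cite: JerrumSnir1982, §4.3 and Cor. 3.5] -/
theorem two_pow_le_complexity_perPoly_mul {h : MvPolynomial (Fin n × Fin n) ℝ≥0}
    (hh : h ≠ 0) (hn : h.totalDegree + 6 ≤ n) :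
    2 ^ ((n - h.totalDegree) / 3) ≤ complexity (perPoly (Fin n) ℝ≥0 * h) + 1 := by
  classical
  obtain ⟨R, hRcard, q, hq, hle⟩ := exists_support_perPoly_complexity_le hh
  have hcardI : Fintype.card {a : Fin n // a ∉ R} = n - R.card := by
    rw [Fintype.card_subtype_compl, Fintype.card_fin, Fintype.card_coe]
  have hm : 6 ≤ Fintype.card {a : Fin n // a ∉ R} := by omega
  have hbound := two_pow_le_complexity_of_support_eq_perPoly hm hq
  rw [hcardI] at hbound
  calc 2 ^ ((n - h.totalDegree) / 3) ≤ 2 ^ ((n - R.card) / 3) :=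
        Nat.pow_le_pow_right two_pos (by omega)
    _ ≤ complexity q := hbound
    _ ≤ complexity (perPoly (Fin n) ℝ≥0 * h) + 1 := hle

end Main

end

end Summit.ValiantsHypothesis.ValiantsHypothesis.Theorems.PerDivisionHard.Negative
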